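import Summits.CriticalPhenomena.Ising3DConformalLimit.Theses.HyperoctahedralRP
import Summits.CriticalPhenomena.Ising3DConformalLimit.Theorems.HyperoctahedralRPTwoPointKernelOfLimit
import Summits.CriticalPhenomena.Ising3DConformalLimit.Theorems.HyperoctahedralRPLimitRotationInvariantQuarterTurnDefs
import Summits.CriticalPhenomena.Ising3DConformalLimit.Theorems.HyperoctahedralRPLimitRotationInvariantLimitRegularity
import Summits.CriticalPhenomena.Ising3DConformalLimit.Theorems.HyperoctahedralRPLimitRotationInvariantNineMirrorRP
import Summits.CriticalPhenomena.Ising3DConformalLimit.Theorems.HyperoctahedralRPLimitRotationInvariantDiamondCross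
import Summits.CriticalPhenomena.Ising3DConformalLimit.Theorems.HyperoctahedralRPLimitRotationInvariantInPlaneLightCone
import Summits.CriticalPhenomena.Ising3DConformalLimit.Theorems.HyperoctahedralRPLimitRotationInvariantBoostEntireOfType
import Summits.CriticalPhenomena.Ising3DConformalLimit.Theorems.HyperoctahedralRPLimitRotationInvariantBoostEntireOfTypeAxis
import Summits.CriticalPhenomena.Ising3DConformalLimit.Theorems.HyperoctahedralRPLimitRotationInvariantFourfoldToFull
import Summits.CriticalPhenomena.Ising3DConformalLimit.Theorems.HyperoctahedralRPLimitRotationInvariantAxisSigmaOfUnit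
import Literature.Analysis.Complex.PeriodicEntireLiouville
import Literature.Probability.LatticeModels.CriticalUrsellFourSign
import HarnessLib

/-!
# Crux `HyperoctahedralRP.LimitRotationInvariant` (stmt-CriticalPhenomena-1980) — skeleton, line `quarter-turn-liouville`
# (v7, lead `prover-line-stmt-CriticalPhenomena-1980-c1-0`, cycle 2: S1a S1b S2a S2b S3'a S4 S4' S6 LANDED and imported; odd levels free;
#  S3'b `stub_unitSigmaBound` PROVED from six new stubs — Markov/FKG lattice sandwich c1 c2 c3a c3b, transfer c4, and the
#  open core `stub_oneArmBound` = one-arm hyperscaling bound on ℤ³)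

Line lead `prover-line-stmt-CriticalPhenomena-1980-0`, 2026-08-16 (reshaped from the crux-plan skeleton of
`planner-cruxplan-stmt-CriticalPhenomena-1980-quarter-turn-liouvil-0`).  Vocabulary: the landed Defs module
`Theorems/HyperoctahedralRPLimitRotationInvariantQuarterTurnDefs.lean` (p86653).

## The line in one paragraph

For a configuration `x` of `n` points and the rotation `rot θ = planeRot 0 θ` about the lattice axis `e₂`, the orbit
function `θ ↦ S n (rot θ ∘ x)` is `π/2`-PERIODIC (the quarter turn is a signed permutation; hyperoctahedral invariance of
every normalised limit, S1a).  Reflection positivity of the limit in the lattice mirrors (S1b) gives, by the bounded cross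
theorem (S2a) + Lukacs, the speed-1 IN-PLANE LIGHT CONE on every OS sector (S2b); with it a rotation by a COMPLEX angle is a
product of heat-semigroup factors, cone contractions and unitaries.  The open input is the TWO-SIDED SIGMA BOUND (S3).
S2b + S3 make an operator calculus in which the orbit function extends to an ENTIRE function of exponential type `2Δ ≤ 2 < 4`
(S4: outer boosted blocks are neutralised by rotation invariance at lower levels — strong induction, base `n = 2` = crux (A)
through the landed `twoPointKernelOfLimit_proof`).  The tree's Liouville theorem for periodic entire functions of small type
makes the orbit function CONSTANT; S6 (density of the axis-generic configurations, the free continuity of limits off the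
diagonals, hyperoctahedral conjugation and Cartan–Dieudonné) upgrades axis-generic `e₂`-invariance to `O(3)` at level `n`.

## Registered stubs — status

* S1a `stub_limitRegularity`   LANDED `Theorems/HyperoctahedralRPLimitRotationInvariantLimitRegularity.lean` (p96960)
* S1b `stub_nineMirrorRP`      LANDED `Theorems/HyperoctahedralRPLimitRotationInvariantNineMirrorRP.lean` (p91732)
* S2a `stub_diamondCross`      LANDED `Theorems/HyperoctahedralRPLimitRotationInvariantDiamondCross.lean` (p94247; discharge of the
  fact `Literature.Uncategorized.DiamondCross` = `Literature/Analysis/Complex/SeparatelyHolomorphicStrips.lean` p91925 + p92645)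
* S2b `stub_inPlaneLightCone`  LANDED `Theorems/HyperoctahedralRPLimitRotationInvariantInPlaneLightCone.lean` (p95535; Literature chain
  `AnalyticCharFunExpMoments`, `LaplaceFourierCone`, `TubeKernelCauchySchwarz`, `MirrorHalfSpaceClusters`, `MirrorClusterOSSpace`,
  `MirrorOSDataOfBounds`, `MirrorBisectorHalfPlane`, `MirrorInPlaneConeSupport`, `MirrorInPlaneLightCone`, `LatticeB2Bisectors`)
* S3'b `stub_unitSigmaBound`    OPEN — THE ONLY OPEN STUB (held by the lead), dimensionless form of the frame-`e₀` instance of the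
  planner's nine-frame S3
* S3'a `stub_axisSigmaBound_of_unit` LANDED `Theorems/HyperoctahedralRPLimitRotationInvariantAxisSigmaOfUnit.lean` (p101104)
* S4' `stub_boostEntireOfTypeAxis` = S4 re-stated over the frame-`e₀` bound, LANDED `Theorems/…BoostEntireOfTypeAxis.lean` (p99358);
  S4 `stub_boostEntireOfType` LANDED `Theorems/HyperoctahedralRPLimitRotationInvariantBoostEntireOfType.lean` (p96589; Literature chain
  `PointwiseOSBoost{Calculus,Vectors,Blocks,Ket,Continuation}`, `Analysis/Complex/PeriodicLocalContinuation`, …)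
* S6  `stub_fourfoldToFull`     LANDED `Theorems/HyperoctahedralRPLimitRotationInvariantFourfoldToFull.lean` (p92952;
  `Literature/Geometry/Euclidean/AxisRotationsGenerate.lean` p91978)

## Disproof used (Disproof.lean of refuter-cdisprove-stmt-CriticalPhenomena-1980-0, cycle 1 final 2026-08-15T22:57Z; the
file is not mounted on this hub — read through its four evidence notes)

* `cruxBody_false_without_scalingLimit` / `not_modelBlindNPointUpgrade`: the scaling-limit hypothesis is consumed at S1a/S1b
  and S3; every model-free stub (S2b, S4) keeps mirror RP among its hypotheses; S6's hypothesis fails for the witness `W₄`.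
* `cruxBody_false_without_normalisation`: normalisation is a conjunct of `LimitRegularity`, load-bearing in S1b and S6.
* No `-- Targets` stub kill and no landed `Negative/` lemma exists for this crux.
-/

noncomputable section

open scoped BigOperators Topology
open Literature.Probability.LatticeModels
open Literature.MathematicalPhysics.QuantumFieldTheory
open Literature.Uncategorized (DiamondCross)
open Summit.CriticalPhenomena.Ising3DConformalLimit.Theses.HyperoctahedralRP

namespace Summit.CriticalPhenomena.Ising3DConformalLimit.Cruxes.LimitRotationInvariant.QuarterTurnLiouville

local notation "E³" => EuclideanSpace ℝ (Fin 3)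

/-! ## The open core after the v7 reshape (lead c1, 2026-08-16): the Markov/one-arm reduction

`stub_unitSigmaBound` (S3'b, the ONE open stub of v6) is now a THEOREM of six registered stubs: the lattice Markov/FKG
sandwich (c1 `stub_boxSandwich`, c2 `stub_midMagnetisation_le`, c3a `stub_symBoxNorm`, c3b `stub_latticeSandwich_of` —
all provable from the tree's finite-volume Ising API), the scaling-limit transfer (c4 `stub_unitSigmaBound_of_LS`), and the NEW
OPEN CORE `stub_oneArmBound` (the one-arm hyperscaling bound `(m⁺_n)² ≤ C ⟨σ₀σ_{2ne₀}⟩_{β_c}` on `ℤ³`).  Vocabulary: the LANDED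
`Theorems/HyperoctahedralRPLimitRotationInvariantMarkovDefs.lean` (p108076, commit 235f4b3c4dd6; it also carries the API stub `stub_planeRefl_planeRefl`).
Blueprint with complete proofs of c1–c4: the lead's `work/briefs/S3c_blueprint.md` (published in Cruxes/…/NOTES.md, lead-c1 addendum). -/



/-! ### Vocabulary (verbatim copy of the landed Theorems/…MarkovDefs.lean, inlined only because the farm has not yet built that module) -/



/-! ### Geometry and finite-volume expectations -/

/-- Reflection of `ℤ³` in the lattice plane `P_h = {x₀ = h}`: `x ↦ (2h − x₀, x₁, x₂)`. [folklore] -/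
def planeRefl (h : ℤ) (x : Site 3) : Site 3 := Function.update x 0 (2 * h - x 0)

/-- The finite box `{x : |x₀ − h| ≤ R, |x₁| ≤ L, |x₂| ≤ L}`, symmetric under `planeRefl h`. [folklore] -/
def symBox (h : ℤ) (R L : ℕ) : Finset (Site 3) :=
  (box 3 (R + h.natAbs)).filter fun x => |x 0 - h| ≤ R ∧ |x 1| ≤ L ∧ |x 2| ≤ L

/-- The part of a finite region strictly below the plane `P_h`. [folklore] -/
def belowPlane (h : ℤ) (Λ : Finset (Site 3)) : Finset (Site 3) := Λ.filter fun x => x 0 < h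

/-- The part of a finite region strictly above the plane `P_h`. [folklore] -/
def abovePlane (h : ℤ) (Λ : Finset (Site 3)) : Finset (Site 3) := Λ.filter fun x => h < x 0

/-- The part of a finite region strictly between the planes `P_h` and `P_h'`. [folklore] -/
def betweenPlanes (h h' : ℤ) (Λ : Finset (Site 3)) : Finset (Site 3) := Λ.filter fun x => h < x 0 ∧ x 0 < h'

/-- Critical finite-volume Ising expectation on `Λ ⊂ ℤ³` with PLUS boundary condition, `⟨F⟩⁺_{Λ;β_c,0}`. [folklore] -/
def critPlusExpect (Λ : Finset (Site 3)) (F : SpinConfig (Site 3) → ℝ) : ℝ :=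
  isingExpect (zdGraph 3) Λ (criticalBeta 3) 0 .plus F

/-- Critical finite-volume Ising expectation on `Λ ⊂ ℤ³` with the boundary condition FIXED to the configuration `σ`
outside `Λ` (the DLR kernel of the critical specification): `⟨F⟩^σ_{Λ;β_c,0}`. [folklore] -/
def critFixedExpect (Λ : Finset (Site 3)) (σ : SpinConfig (Site 3)) (F : SpinConfig (Site 3) → ℝ) : ℝ :=
  isingExpect (zdGraph 3) Λ (criticalBeta 3) 0 (.fixed σ) F

/-- The plus-boundary magnetisation at the centre of the cube `Λ_n = [−n,n]³` at `β_c`: `m⁺_n := ⟨σ_0⟩⁺_{Λ_n;β_c,0}`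
(= the wired FK–Ising one-arm probability to `∂Λ_{n+1}`, `thetaWiredBox_succ_eq_isingCorr_plus`). [folklore] -/
def plusBoxMag (n : ℕ) : ℝ := isingCorr (zdGraph 3) (box 3 n) (criticalBeta 3) 0 .plus {0}

/-- **(LS) · the lattice sandwich inequality at level `n`** (a predicate on `n : ℕ`): in the critical state on `ℤ³`, a spin `σ_y` on the plane
`x₀ = 0` sandwiched between a signed combination of spin monomials supported in `{x₀ ≤ −n}` and one supported in
`{x₀ ≥ n}` is bounded by `m⁺_{n−1}` times the two Osterwalder–Schrader norms taken with respect to the mirrors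
`P_{−n}` and `P_n`. [folklore] -/
def LatticeSandwich (n : ℕ) : Prop :=
  1 ≤ n → ∀ (y : Site 3), y 0 = 0 →
    ∀ (m : ℕ) (k : Fin m → ℕ) (J : (a : Fin m) → Fin (k a) → Site 3) (c : Fin m → ℝ)
      (m' : ℕ) (k' : Fin m' → ℕ) (K : (b : Fin m') → Fin (k' b) → Site 3) (d : Fin m' → ℝ),
      (∀ a i, J a i 0 ≤ -(n : ℤ)) → (∀ b j, (n : ℤ) ≤ K b j 0) →
      (∑ a, ∑ b, c a * d b *
          criticalCorr 3 (k a + 1 + k' b) (Fin.append (Fin.append (J a) ![y]) (K b))) ^ 2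
        ≤ plusBoxMag (n - 1) ^ 2 *
          (∑ a, ∑ a', c a * c a' *
            criticalCorr 3 (k a + k a') (Fin.append (J a) (fun i => planeRefl (-(n : ℤ)) (J a' i)))) *
          (∑ b, ∑ b', d b * d b' *
            criticalCorr 3 (k' b + k' b') (Fin.append (K b) (fun j => planeRefl n (K b' j))))

/-- **(OA) · the one-arm hyperscaling bound with constant `C`** (a predicate on `C : ℝ`; the stub asserts `∃ C, OneArmBound C`): the plus-box magnetisation at the centre of `Λ_n` at `β_c`
is at most a constant times the square root of the critical two-point function at distance `2n` along an axis.
TRUE by scaling theory in `d = 3` (both sides `≍ n^{-Δσ}` after the square root), its converse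
`⟨σ₀σ_{2ne₀}⟩ ≤ m_wall(n)²` is a theorem (plane contraction, GKS), and it FAILS for `d > 4` (hyperscaling):
the open core of the line after the Markov reshape. [folklore] -/
def OneArmBound (C : ℝ) : Prop :=
  ∀ n : ℕ, 1 ≤ n → plusBoxMag n ^ 2 ≤ C * criticalCorr 3 2 ![0, Pi.single 0 (2 * (n : ℤ))]

/-- **Statement (c1) · finite-box Markov sandwich at level `n`.**  In the critical plus-boundary Ising measure on the slab box
`B = symBox 0 M L`, for bounded measurable `F` depending only on `{x₀ ≤ −n}` and `G` depending only on `{x₀ ≥ n}` and a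
site `y` on the plane `x₀ = 0`: `|⟨F σ_y G⟩_B| ≤ m · ⟨φ²⟩_B^{1/2} · ⟨ψ²⟩_B^{1/2}`, where `φ(σ) = ⟨F⟩^σ_{B ∩ {x₀ < −n}}`,
`ψ(σ) = ⟨G⟩^σ_{B ∩ {x₀ > n}}` are the DLR conditional expectations given the configuration off the two outer regions, and `m`
is any pointwise bound of the conditional magnetisation `σ ↦ ⟨σ_y⟩^σ_{B ∩ {|x₀| < n}}` (spatial Markov property of the
nearest-neighbour Gibbs weight across the plane sections `x₀ = ±n`, then Cauchy–Schwarz). [folklore] -/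
def BoxSandwichStatement (n : ℕ) : Prop :=
  ∀ (L M : ℕ), 1 ≤ n → n < M → ∀ (y : Site 3), y 0 = 0 → (∀ i, i ≠ 0 → |y i| ≤ L) →
    ∀ (F G : SpinConfig (Site 3) → ℝ), Measurable F → Measurable G →
      DependsOn F {x : Site 3 | x 0 ≤ -(n : ℤ)} → DependsOn G {x : Site 3 | (n : ℤ) ≤ x 0} →
      (∃ CF : ℝ, ∀ σ, |F σ| ≤ CF) → (∃ CG : ℝ, ∀ σ, |G σ| ≤ CG) →
    ∀ (mb : ℝ), (∀ σ : SpinConfig (Site 3),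
        |critFixedExpect (betweenPlanes (-(n : ℤ)) n (symBox 0 M L)) σ (spinAt y)| ≤ mb) →
      |critPlusExpect (symBox 0 M L) (fun σ => F σ * spinAt y σ * G σ)| ≤
        mb * Real.sqrt (critPlusExpect (symBox 0 M L)
                (fun σ => critFixedExpect (belowPlane (-(n : ℤ)) (symBox 0 M L)) σ F ^ 2)) *
             Real.sqrt (critPlusExpect (symBox 0 M L)
                (fun σ => critFixedExpect (abovePlane n (symBox 0 M L)) σ G ^ 2))

/-- **Statement (c2) · conditional magnetisation bound at level `n`.**  For every boundary configuration `σ`, the magnetisation of the plane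
spin `σ_y` in the slab piece `B ∩ {|x₀| < n}` is at most the plus-box magnetisation `m⁺_{n−1}` in absolute value (FKG
monotonicity in the boundary spins of either sign, spin flip, shrinking the domain under plus boundary condition,
translation). [folklore] -/
def MidMagnetisationStatement (n : ℕ) : Prop :=
  ∀ (L M : ℕ), 1 ≤ n → n < M → ∀ (y : Site 3), y 0 = 0 → (∀ i, i ≠ 0 → |y i| + n ≤ (L : ℤ)) →
    ∀ σ : SpinConfig (Site 3),
      |critFixedExpect (betweenPlanes (-(n : ℤ)) n (symBox 0 M L)) σ (spinAt y)| ≤ plusBoxMag (n - 1)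

/-- **Statement (c3a) · symmetric-box norm identity at level `n`.**  With `ψ(σ) = ⟨G⟩^σ_{B ∩ {x₀ > n}}` as in (c1) and the box
`B₊ = symBox n (M − n) L` (same upper part as `B`, symmetric under the reflection `planeRefl n`):
`⟨ψ²⟩_B = ⟨G · (G ∘ planeRefl n)⟩_{B₊} + (⟨G ψ⟩_B − ⟨G ψ⟩_{B₊})` (conditioning on the complement of the upper region in `B`
and in `B₊`, and the reflection symmetry of `B₊`). [folklore] -/
def SymBoxNormStatement (n : ℕ) : Prop :=
  ∀ (L M : ℕ), 1 ≤ n → 3 * n < M →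
    ∀ (G : SpinConfig (Site 3) → ℝ), Measurable G → DependsOn G {x : Site 3 | (n : ℤ) ≤ x 0} →
      DependsOn G (↑(abovePlane (n : ℤ) (symBox 0 M L) ∪ (symBox 0 M L).filter fun x => x 0 = n) : Set (Site 3)) →
      (∃ CG : ℝ, ∀ σ, |G σ| ≤ CG) →
      critPlusExpect (symBox 0 M L) (fun σ => critFixedExpect (abovePlane n (symBox 0 M L)) σ G ^ 2) =
        critPlusExpect (symBox n (M - n) L) (fun σ => G σ * G (σ ∘ planeRefl n)) +
        (critPlusExpect (symBox 0 M L) (fun σ => G σ * critFixedExpect (abovePlane n (symBox 0 M L)) σ G) -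
          critPlusExpect (symBox n (M - n) L) (fun σ => G σ * critFixedExpect (abovePlane n (symBox 0 M L)) σ G))

/-- **The unit sigma bound** (conclusion of the registered stub `stub_unitSigmaBound` of the line, as a `Prop` in `(ρ, Δ, S)`):
`‖e^{-H} σ̂(y) e^{-H}‖ ≤ C₁` on the Osterwalder–Schrader space of the mirror `x₀ = 0`, correlation-function form. [folklore] -/
def UnitSigmaBound (S : CorrFamily 3) : Prop :=
  ∃ C₁ : ℝ, ∀ y : EuclideanSpace ℝ (Fin 3), y 0 = 0 →
    ∀ (m : ℕ) (k : Fin m → ℕ) (A : (a : Fin m) → Fin (k a) → EuclideanSpace ℝ (Fin 3)) (c : Fin m → ℝ)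
      (m' : ℕ) (k' : Fin m' → ℕ) (B : (b : Fin m') → Fin (k' b) → EuclideanSpace ℝ (Fin 3))
      (d : Fin m' → ℝ),
      (∀ a i, 0 < A a i 0) → (∀ b j, 0 < B b j 0) →
      (∑ a, ∑ b, c a * d b * S (k a + 1 + k' b)
          (Fin.append (Fin.append (fun i => axisReflection 0 (A a i + EuclideanSpace.single 0 1)) ![y])
            (fun j => B b j + EuclideanSpace.single 0 1))) ^ 2
        ≤ C₁ ^ 2 *
          (∑ a, ∑ a', c a * c a' * S (k a + k a')
            (Fin.append (fun i => axisReflection 0 (A a i)) (A a'))) *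
          (∑ b, ∑ b', d b * d b' * S (k' b + k' b')
            (Fin.append (fun j => axisReflection 0 (B b j)) (B b')))

/-- `planeRefl h` is an involution. [folklore] -/
theorem planeRefl_planeRefl (h : ℤ) (x : Site 3) : planeRefl h (planeRefl h x) = x := by
  ext i
  by_cases hi : i = 0
  · subst hi; simp [planeRefl]
  · simp [planeRefl, hi]

/-- `planeRefl h` is an involution (the registered API sub-goal of skeleton v7, in its registered form). [folklore] -/
theorem stub_planeRefl_planeRefl : ∀ (h : ℤ) (x : Site 3), planeRefl h (planeRefl h x) = x :=
  planeRefl_planeRefl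

/-- `planeRefl h` fixes the plane `x₀ = h` pointwise. [folklore] -/
theorem planeRefl_of_eq {h : ℤ} {x : Site 3} (hx : x 0 = h) : planeRefl h x = x := by
  ext i
  by_cases hi : i = 0
  · subst hi; simp [planeRefl, hx]; ring
  · simp [planeRefl, hi]

/-- The zeroth coordinate of `planeRefl h x` is `2h − x₀`. [folklore] -/
@[simp] theorem planeRefl_apply_zero (h : ℤ) (x : Site 3) : planeRefl h x 0 = 2 * h - x 0 := by
  simp [planeRefl]

/-- The other coordinates are unchanged by `planeRefl h`. [folklore] -/
theorem planeRefl_apply_of_ne_zero (h : ℤ) (x : Site 3) {i : Fin 3} (hi : i ≠ 0) : planeRefl h x i = x i := by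
  simp [planeRefl, hi]

/-- Membership in `symBox h R L`. [folklore] -/
theorem mem_symBox {h : ℤ} {R L : ℕ} {x : Site 3} :
    x ∈ symBox h R L ↔ x ∈ box 3 (R + h.natAbs) ∧ |x 0 - h| ≤ R ∧ |x 1| ≤ L ∧ |x 2| ≤ L := by
  simp [symBox]


/-! ### The six stubs of v7 -/

/-- S3'd (OPEN CORE). -/
theorem stub_oneArmBound : ∃ C : ℝ, OneArmBound C := by
  sorry

/-- **The converse of (OA) is a theorem** (registered as an API sub-goal so that it can be landed `--supports`; not used by the
composition): `⟨σ₀σ_{2ne₀}⟩_{β_c} ≤ (m⁺_{n−1})²`.  Proof: the infinite-volume plus state is dominated by every finite-volume plus state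
(`plusCorr ≤ isingCorr Λ .plus`); take `Λ = H ∪ θ_{P_n}H` with `H = {−n ≤ x₀ ≤ n−1, |x₁|,|x₂| ≤ n}` — the plane section `x₀ = n` is then part of
the plus boundary, the two halves are separated, so `⟨σ₀σ_{2ne₀}⟩⁺_Λ = ⟨σ₀⟩⁺_H ⟨σ_{2ne₀}⟩⁺_{θH} = (⟨σ₀⟩⁺_H)²` (reflection symmetry), and
`⟨σ₀⟩⁺_H ≤ ⟨σ₀⟩⁺_{Λ_{n−1}} = m⁺_{n−1}` because `Λ_{n−1} ⊆ H` (plus correlations decrease in the volume).  So (OA) says exactly that this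
inequality is sharp up to a constant (and the index shift). [folklore] -/
theorem stub_oneArmConverse :
    ∀ n : ℕ, 1 ≤ n → criticalCorr 3 2 ![0, Pi.single 0 (2 * (n : ℤ))] ≤ plusBoxMag (n - 1) ^ 2 := by
  sorry

/-- S3'c1 · finite-box Markov sandwich. -/
theorem stub_boxSandwich : ∀ n : ℕ, BoxSandwichStatement n := by
  sorry

/-- S3'c2 · conditional magnetisation bound. -/
theorem stub_midMagnetisation_le : ∀ n : ℕ, MidMagnetisationStatement n := by
  sorry

/-- S3'c3a · symmetric-box norm identity. -/
theorem stub_symBoxNorm : ∀ n : ℕ, SymBoxNormStatement n := by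
  sorry

/-- S3'c3b · limits: (c1) ∧ (c2) ∧ (c3a) ⟹ (LS). -/
theorem stub_latticeSandwich_of :
    ∀ n : ℕ, BoxSandwichStatement n → MidMagnetisationStatement n → SymBoxNormStatement n → LatticeSandwich n := by
  sorry

/-- S3'c4 · scaling-limit transfer: (LS) ∧ (OA) ∧ CruxHyp ⟹ the unit sigma bound. -/
theorem stub_unitSigmaBound_of_LS :
    (∀ n : ℕ, LatticeSandwich n) → (∃ C : ℝ, OneArmBound C) →
      ∀ (ρ : ℝ → ℝ) (Δ : ℝ) (S : CorrFamily 3), CruxHyp ρ Δ S → UnitSigmaBound S := by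
  sorry

/-- S3'b is now a theorem of the six stubs (same name and statement as the registered stub of v6). -/
theorem stub_unitSigmaBound :
    HRP2Rigidity → ∀ (ρ : ℝ → ℝ) (Δ : ℝ) (S : CorrFamily 3), CruxHyp ρ Δ S →
      ∃ C₁ : ℝ, ∀ y : EuclideanSpace ℝ (Fin 3), y 0 = 0 →
        ∀ (m : ℕ) (k : Fin m → ℕ) (A : (a : Fin m) → Fin (k a) → EuclideanSpace ℝ (Fin 3)) (c : Fin m → ℝ)
          (m' : ℕ) (k' : Fin m' → ℕ) (B : (b : Fin m') → Fin (k' b) → EuclideanSpace ℝ (Fin 3))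
          (d : Fin m' → ℝ),
          (∀ a i, 0 < A a i 0) → (∀ b j, 0 < B b j 0) →
          (∑ a, ∑ b, c a * d b * S (k a + 1 + k' b)
              (Fin.append (Fin.append (fun i => axisReflection 0 (A a i + EuclideanSpace.single 0 1)) ![y])
                (fun j => B b j + EuclideanSpace.single 0 1))) ^ 2
            ≤ C₁ ^ 2 *
              (∑ a, ∑ a', c a * c a' * S (k a + k a')
                (Fin.append (fun i => axisReflection 0 (A a i)) (A a'))) *
              (∑ b, ∑ b', d b * d b' * S (k' b + k' b')
                (Fin.append (fun j => axisReflection 0 (B b j)) (B b'))) :=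
  fun _hA ρ Δ S hH =>
    stub_unitSigmaBound_of_LS
      (fun n => stub_latticeSandwich_of n (stub_boxSandwich n) (stub_midMagnetisation_le n) (stub_symBoxNorm n))
      stub_oneArmBound ρ Δ S hH



/-! ## Base of the induction (proved): levels 0, 1 by translation invariance, level 2 = crux (A) through the landed
support item `TwoPointKernelOfLimit` -/

/-- Level `0`: nothing to rotate. -/
theorem rotInvAt_zero (S : CorrFamily 3) : RotInvAt S 0 := by
  intro R x
  congr 1
  funext i
  exact Fin.elim0 i

/-- Level `1`: translation invariance. -/
theorem rotInvAt_one {S : CorrFamily 3} (htr : IsTranslationInvariant S) : RotInvAt S 1 := by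
  intro R x
  have h1 : ∀ y : Fin 1 → E³, S 1 y = S 1 (fun _ => 0) := by
    intro y
    have h := htr 1 (-(y 0)) y
    rw [← h]
    congr 1
    funext i
    fin_cases i
    simp
  rw [h1 (fun i => R (x i)), h1 x]

/-- Level `2`: crux (A) `HRP2Rigidity` applied to the kernel `S 2 ![0, ·]`, whose hypotheses are the landed support item
`TwoPointKernelOfLimit`. -/
theorem rotInvAt_two (hA : HRP2Rigidity) {ρ : ℝ → ℝ} {Δ : ℝ} {S : CorrFamily 3} (hH : CruxHyp ρ Δ S) :
    RotInvAt S 2 := by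
  obtain ⟨hρ, hlim, _hnorm, hnd, htr, hsc⟩ := hH
  obtain ⟨hΔ, hK, hpos, hhom, hmir⟩ :=
    HyperoctahedralRPTwoPoint.twoPointKernelOfLimit_proof ρ Δ S hρ hlim hnd htr hsc
  have hiso : ∀ (R : E³ ≃ₗᵢ[ℝ] E³) (v : E³), S 2 ![0, R v] = S 2 ![0, v] :=
    hA Δ (fun v => S 2 ![0, v]) hΔ.1 hΔ.2 hK hpos hhom hmir
  have key : ∀ y : Fin 2 → E³, S 2 y = S 2 ![0, y 1 - y 0] := by
    intro y
    have h := htr 2 (-(y 0)) y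
    rw [← h]
    congr 1
    funext i
    fin_cases i <;> simp
    abel
  intro R x
  rw [key (fun i => R (x i)), key x]
  show S 2 ![0, R (x 1) - R (x 0)] = S 2 ![0, x 1 - x 0]
  have hsub : R (x 1) - R (x 0) = R (x 1 - x 0) := (map_sub R (x 1) (x 0)).symm
  rw [hsub]
  exact hiso R _

/-- **Odd levels are trivial.**  Every normalised pointwise scaling limit of the critical `ℤ³` correlators
vanishes identically at odd levels: on `NonCoincident` it is the locally uniform limit of
`ρ(δ)ⁿ · ⟨∏ σ⟩⁺_{β_c} = 0` (`criticalCorr_eq_zero_of_odd`, i.e. `m*(β_c) = 0`, ADS 2015), and off `NonCoincident` it is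
`0` by normalisation.  Hence the first open level of the crux is `n = 4`. -/
theorem limit_odd_eq_zero {ρ : ℝ → ℝ} {Δ : ℝ} {S : CorrFamily 3} (hH : CruxHyp ρ Δ S) {n : ℕ} (hn : Odd n)
    (x : Fin n → E³) : S n x = 0 := by
  obtain ⟨_, hlim, hnorm, _, _, _⟩ := hH
  by_cases hx : x ∈ NonCoincident 3 n
  · have h0 : Filter.Tendsto (fun δ => rescaledCorrelator (criticalCorr 3) ρ n δ x) (𝓝[>] (0 : ℝ)) (𝓝 0) := by
      refine tendsto_const_nhds.congr fun δ => ?_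
      rw [rescaledCorrelator_apply, criticalCorr_eq_zero_of_odd (d := 3) le_rfl hn, mul_zero]
    exact tendsto_nhds_unique ((hlim n).tendsto_at hx) h0
  · exact hnorm n x hx

/-- Rotation invariance at every odd level (both sides vanish). -/
theorem rotInvAt_odd {ρ : ℝ → ℝ} {Δ : ℝ} {S : CorrFamily 3} (hH : CruxHyp ρ Δ S) {n : ℕ} (hn : Odd n) :
    RotInvAt S n := by
  intro R x
  rw [limit_odd_eq_zero hH hn, limit_odd_eq_zero hH hn]

/-- An entire function that is `T`-periodic on the real axis is `T`-periodic (identity theorem). -/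
theorem periodic_of_real_periodic {F : ℂ → ℂ} (hF : Differentiable ℂ F) {T : ℝ}
    (h : ∀ θ : ℝ, F ((θ : ℂ) + (T : ℂ)) = F (θ : ℂ)) : ∀ z : ℂ, F (z + (T : ℂ)) = F z := by
  have hGd : Differentiable ℂ (fun z : ℂ => F (z + (T : ℂ))) :=
    hF.comp (differentiable_id.add_const _)
  have hGa : AnalyticOnNhd ℂ (fun z : ℂ => F (z + (T : ℂ))) Set.univ :=
    Complex.analyticOnNhd_univ_iff_differentiable.mpr hGd
  have hFa : AnalyticOnNhd ℂ F Set.univ := Complex.analyticOnNhd_univ_iff_differentiable.mpr hF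
  have ht : Filter.Tendsto (fun θ : ℝ => (θ : ℂ)) (𝓝[≠] 0) (𝓝[≠] 0) := by
    have hc : ContinuousWithinAt (fun θ : ℝ => (θ : ℂ)) {(0 : ℝ)}ᶜ 0 :=
      Complex.continuous_ofReal.continuousWithinAt
    have hm : Set.MapsTo (fun θ : ℝ => (θ : ℂ)) {(0 : ℝ)}ᶜ {(0 : ℂ)}ᶜ := by
      intro θ hθ
      simpa using hθ
    simpa using hc.tendsto_nhdsWithin hm
  have hfreq : ∃ᶠ z in 𝓝[≠] (0 : ℂ), (fun z : ℂ => F (z + (T : ℂ))) z = F z :=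
    ht.frequently (Filter.Eventually.of_forall fun θ => h θ).frequently
  have key := hGa.eq_of_frequently_eq hFa hfreq
  intro z
  exact congrFun key z

/-! ## The composition (kernel-checked): the seven stubs prove the crux BY NAME -/

/-- **`LimitRotationInvariant_of`** — crux (B) `HyperoctahedralRP.LimitRotationInvariant` (item stmt-CriticalPhenomena-1980)
from the seven stubs (six landed and imported, S3' open), by strong induction on the level `n`: levels `0, 1` by translation
invariance, level `2` by crux (A) (the crux's own hypothesis) through `twoPointKernelOfLimit_proof`; level `n ≥ 3`: S4 (fed
S1a, S1b, S2a, S2b, S3 and the induction hypothesis) gives an entire orbit function of type `τ < 4`, hyperoctahedral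
invariance (S1a) + `orbit_periodic` + `periodic_of_real_periodic` make it `π/2`-periodic, the tree's
`apply_eq_apply_of_periodic_of_norm_le_exp` (`T = π/2`, `τ·π/2 < 2π`) makes it constant — rotation invariance about `e₂` at
axis-generic configurations — and S6 upgrades to all of `O(3)` at level `n`. -/
theorem LimitRotationInvariant_of :
    _root_.Summit.CriticalPhenomena.Ising3DConformalLimit.Theses.HyperoctahedralRP.LimitRotationInvariant := by
  intro hA ρ Δ S hρ hlim hnorm hnd htr hsc
  have hH : CruxHyp ρ Δ S := ⟨hρ, hlim, hnorm, hnd, htr, hsc⟩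
  have hL : LimitStructure Δ S := ⟨stub_limitRegularity ρ Δ S hH, stub_nineMirrorRP ρ Δ S hH⟩
  have hcone : InPlaneLightCone S := stub_inPlaneLightCone stub_diamondCross Δ S hL
  have hsig := stub_axisSigmaBound_of_unit Δ S hL (stub_unitSigmaBound hA ρ Δ S hH)
  have hO : IsHyperoctahedralInvariant S := hL.1.2.2.2.2.2.1
  have key : ∀ n : ℕ, RotInvAt S n := by
    intro n
    induction n using Nat.strong_induction_on with
    | _ n ih =>
      rcases Nat.lt_or_ge n 3 with hn | hn
      · interval_cases n
        · exact rotInvAt_zero S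
        · exact rotInvAt_one htr
        · exact rotInvAt_two hA hH
      · rcases Nat.even_or_odd n with _hev | hodd
        swap
        · exact rotInvAt_odd hH hodd
        -- even level `n ≥ 4`: the boost step S4' (fed by the one open stub S3'b through S3'a) + Liouville + S6
        refine stub_fourfoldToFull Δ S hL n ?_
        intro x hx θ
        obtain ⟨F, hFd, hFx, C, τ, hτ, hFb⟩ :=
          stub_boostEntireOfTypeAxis Δ S hL hcone hsig n hn ih x hx
        -- periodicity of `F`: hyperoctahedral invariance on the real axis + identity theorem
        have hFp : ∀ z : ℂ, F (z + ((Real.pi / 2 : ℝ) : ℂ)) = F z := by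
          refine periodic_of_real_periodic hFd fun θ => ?_
          have e : (θ : ℂ) + ((Real.pi / 2 : ℝ) : ℂ) = ((θ + Real.pi / 2 : ℝ) : ℂ) := by push_cast; ring
          rw [e, hFx, hFx, orbit_periodic hO x θ]
        have hT : (0 : ℝ) < Real.pi / 2 := by positivity
        have hτT : τ * (Real.pi / 2) < 2 * Real.pi := by
          nlinarith [Real.pi_pos, hτ, mul_pos (sub_pos.mpr hτ) Real.pi_pos]
        have hc : F (θ : ℂ) = F ((0 : ℝ) : ℂ) :=
          Literature.Analysis.Complex.apply_eq_apply_of_periodic_of_norm_le_exp hT hτT hFd hFp hFb _ _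
        have e1 : ((S n (fun i => rot θ (x i)) : ℝ) : ℂ) = ((S n (fun i => rot 0 (x i)) : ℝ) : ℂ) := by
          rw [← hFx θ, ← hFx 0]
          exact hc
        have e2 : S n (fun i => rot θ (x i)) = S n (fun i => rot 0 (x i)) := by
          exact_mod_cast e1
        rw [e2]
        congr 1
        funext i
        exact rot_zero_apply (x i)
  intro n R x
  exact key n R x

end Summit.CriticalPhenomena.Ising3DConformalLimit.Cruxes.LimitRotationInvariant.QuarterTurnLiouville

end
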